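import Mathlib
import Summits.QuantumAdvantage.QuantumAdvantage.Theses.SymplecticPurity
import Summits.QuantumAdvantage.QuantumAdvantage.Theorems.SymplecticPuritySymplecticPurityBoundPauli
import Summits.QuantumAdvantage.QuantumAdvantage.Theorems.SymplecticPuritySymplecticPurityBoundKernel
import Summits.QuantumAdvantage.QuantumAdvantage.Theorems.SymplecticPuritySymplecticPurityBoundTensor
import Summits.QuantumAdvantage.QuantumAdvantage.Theorems.SymplecticPuritySymplecticPurityBoundCounting

/-!
# Route SymplecticPurity · item SymplecticPurityBound (stmt-QuantumAdvantage-10729) — proof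

**Theorem** (`SymplecticPurityBound_proof`). Let `ψ` be a unit vector on `n ≥ 1` qubits with
`|⟨ψ|σ_S|ψ⟩| ≤ ε` for every Pauli string `S ≠ I`, and let `U` be a semantic Clifford unitary on
`n + m` qubits (`U σ_S U† = c σ_{S'}`, `|c| = 1`, for every string `S`). Then some linear cut
`{wires < k}` of `U(ψ ⊗ |0^m⟩)` has purity (four-fold agreement sum) at most `4ε`.

Proof (as planned on the route, constant `3`): by the helper files, for the cut `A_k = {i < k}`
the purity is at most `u_k + ε²/u_k` with `u_k = a_k / 2^k`, where `a_k` counts the diagonal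
ancilla labels `R ∈ {I,Z}^m` whose image `f(I^n ⊗ R)` under the label map of `U` is supported in
`A_k` (the stabilizers of the state inside the cut). The sequence `a_k` is monotone with `a_0 = 1`
and `a_{n+m} = 2^m`, so `u_0 = 1`, `u_{n+m} = 2^{-n}` and `u_{k+1} ≥ u_k / 2`: at the first `k` with
`u_k ≤ 2ε` one has `u_k > ε`, whence purity `≤ 2ε + ε = 3ε`. The degenerate ranges are direct:
`ε ≥ 1/4` (cut `k = 0`, purity `1`) and `2ε < 2^{-n}` (impossible: at `k = n + m` the purity is `1`
while the bound is `< 1`).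
-/

noncomputable section

set_option linter.dupNamespace false -- D-0017: single-problem summit ⇒ `QuantumAdvantage.QuantumAdvantage` by design

open Matrix Finset
open Literature.Computability.QuantumComplexity Literature.Computability.Cryptography

namespace Summit.QuantumAdvantage.QuantumAdvantage.Theorems.SymplecticPurity

/-! ## Linear cuts -/

/-- The four-fold sum written with the cut `k` (as on the route) is the four-fold sum of the wire
set `A_k = {i : i < k}`. -/
theorem fourFold_cut_eq {N : ℕ} (k : ℕ) (φ : (Fin N → Bool) → ℂ)
    [D : ∀ x₁ x₂ x₃ x₄ : Fin N → Bool, Decidable ((∀ i : Fin N, k ≤ i.val → x₁ i = x₂ i) ∧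
      (∀ i : Fin N, i.val < k → x₂ i = x₃ i) ∧ (∀ i : Fin N, k ≤ i.val → x₃ i = x₄ i) ∧
      (∀ i : Fin N, i.val < k → x₄ i = x₁ i))]
    [D' : ∀ x₁ x₂ x₃ x₄ : Fin N → Bool, Decidable
      ((∀ i ∉ (Finset.univ.filter fun i : Fin N => i.val < k), x₁ i = x₂ i) ∧
      (∀ i ∈ (Finset.univ.filter fun i : Fin N => i.val < k), x₂ i = x₃ i) ∧
      (∀ i ∉ (Finset.univ.filter fun i : Fin N => i.val < k), x₃ i = x₄ i) ∧
      (∀ i ∈ (Finset.univ.filter fun i : Fin N => i.val < k), x₄ i = x₁ i))] :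
    (∑ x₁ : Fin N → Bool, ∑ x₂ : Fin N → Bool, ∑ x₃ : Fin N → Bool, ∑ x₄ : Fin N → Bool,
      (if (∀ i : Fin N, k ≤ i.val → x₁ i = x₂ i) ∧ (∀ i : Fin N, i.val < k → x₂ i = x₃ i) ∧
          (∀ i : Fin N, k ≤ i.val → x₃ i = x₄ i) ∧ (∀ i : Fin N, i.val < k → x₄ i = x₁ i)
       then φ x₁ * star (φ x₂) * φ x₃ * star (φ x₄) else 0)) =
    ∑ x₁ : Fin N → Bool, ∑ x₂ : Fin N → Bool, ∑ x₃ : Fin N → Bool, ∑ x₄ : Fin N → Bool,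
      (if (∀ i ∉ (Finset.univ.filter fun i : Fin N => i.val < k), x₁ i = x₂ i) ∧
          (∀ i ∈ (Finset.univ.filter fun i : Fin N => i.val < k), x₂ i = x₃ i) ∧
          (∀ i ∉ (Finset.univ.filter fun i : Fin N => i.val < k), x₃ i = x₄ i) ∧
          (∀ i ∈ (Finset.univ.filter fun i : Fin N => i.val < k), x₄ i = x₁ i)
       then φ x₁ * star (φ x₂) * φ x₃ * star (φ x₄) else 0) := by
  refine Finset.sum_congr rfl fun x₁ _ => Finset.sum_congr rfl fun x₂ _ =>
    Finset.sum_congr rfl fun x₃ _ => Finset.sum_congr rfl fun x₄ _ => if_congr ?_ rfl rfl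
  simp only [Finset.mem_filter, Finset.mem_univ, true_and, not_lt]

/-- At the empty cut `k = 0` the four-fold sum is `‖φ‖⁴`. -/
theorem fourFold_cut_zero {N : ℕ} (φ : (Fin N → Bool) → ℂ)
    [D : ∀ x₁ x₂ x₃ x₄ : Fin N → Bool, Decidable ((∀ i : Fin N, 0 ≤ i.val → x₁ i = x₂ i) ∧
      (∀ i : Fin N, i.val < 0 → x₂ i = x₃ i) ∧ (∀ i : Fin N, 0 ≤ i.val → x₃ i = x₄ i) ∧
      (∀ i : Fin N, i.val < 0 → x₄ i = x₁ i))] :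
    (∑ x₁ : Fin N → Bool, ∑ x₂ : Fin N → Bool, ∑ x₃ : Fin N → Bool, ∑ x₄ : Fin N → Bool,
      (if (∀ i : Fin N, 0 ≤ i.val → x₁ i = x₂ i) ∧ (∀ i : Fin N, i.val < 0 → x₂ i = x₃ i) ∧
          (∀ i : Fin N, 0 ≤ i.val → x₃ i = x₄ i) ∧ (∀ i : Fin N, i.val < 0 → x₄ i = x₁ i)
       then φ x₁ * star (φ x₂) * φ x₃ * star (φ x₄) else 0)) =
      (((∑ x, ‖φ x‖ ^ 2) ^ 2 : ℝ) : ℂ) := by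
  classical
  rw [← fourFold_empty φ]
  refine Finset.sum_congr rfl fun x₁ _ => Finset.sum_congr rfl fun x₂ _ =>
    Finset.sum_congr rfl fun x₃ _ => Finset.sum_congr rfl fun x₄ _ => if_congr ?_ rfl rfl
  simp only [Nat.zero_le, true_implies, Nat.not_lt_zero, false_implies, implies_true,
    Finset.notMem_empty, not_false_eq_true]

/-- At the full cut `k = N` the four-fold sum is `‖φ‖⁴`. -/
theorem fourFold_cut_top {N : ℕ} (φ : (Fin N → Bool) → ℂ)
    [D : ∀ x₁ x₂ x₃ x₄ : Fin N → Bool, Decidable ((∀ i : Fin N, N ≤ i.val → x₁ i = x₂ i) ∧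
      (∀ i : Fin N, i.val < N → x₂ i = x₃ i) ∧ (∀ i : Fin N, N ≤ i.val → x₃ i = x₄ i) ∧
      (∀ i : Fin N, i.val < N → x₄ i = x₁ i))] :
    (∑ x₁ : Fin N → Bool, ∑ x₂ : Fin N → Bool, ∑ x₃ : Fin N → Bool, ∑ x₄ : Fin N → Bool,
      (if (∀ i : Fin N, N ≤ i.val → x₁ i = x₂ i) ∧ (∀ i : Fin N, i.val < N → x₂ i = x₃ i) ∧
          (∀ i : Fin N, N ≤ i.val → x₃ i = x₄ i) ∧ (∀ i : Fin N, i.val < N → x₄ i = x₁ i)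
       then φ x₁ * star (φ x₂) * φ x₃ * star (φ x₄) else 0)) =
      (((∑ x, ‖φ x‖ ^ 2) ^ 2 : ℝ) : ℂ) := by
  classical
  rw [← fourFold_univ φ]
  refine Finset.sum_congr rfl fun x₁ _ => Finset.sum_congr rfl fun x₂ _ =>
    Finset.sum_congr rfl fun x₃ _ => Finset.sum_congr rfl fun x₄ _ => if_congr ?_ rfl rfl
  have h1 : ∀ i : Fin N, ¬ (N ≤ i.val) := fun i => not_le.2 i.isLt
  simp only [h1, false_implies, implies_true, Fin.is_lt, true_implies, Finset.mem_univ,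
    not_true_eq_false, true_and]

/-! ## First passage of a halving-bounded sequence -/

/-- **Discrete first passage**: a monotone `a : ℕ → ℕ` with `a 0 = 1` and `a N / 2^N ≤ 2ε < 1`
passes through the window `(ε, 2ε]`: some `k ≤ N` has `ε < a k / 2^k ≤ 2ε` (the ratios
`a k / 2^k` at consecutive indices differ by a factor at least `1/2`). -/
theorem exists_first_passage (a : ℕ → ℕ) (hmono : ∀ k, a k ≤ a (k + 1)) (h0 : a 0 = 1) (N : ℕ)
    (ε : ℝ) (hε : 2 * ε < 1) (hN : (a N : ℝ) / 2 ^ N ≤ 2 * ε) :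
    ∃ k ≤ N, ε < (a k : ℝ) / 2 ^ k ∧ (a k : ℝ) / 2 ^ k ≤ 2 * ε := by
  classical
  have hex : ∃ k, (a k : ℝ) / 2 ^ k ≤ 2 * ε := ⟨N, hN⟩
  have hspec := Nat.find_spec hex
  have hle : Nat.find hex ≤ N := Nat.find_min' hex hN
  have hne : Nat.find hex ≠ 0 := by
    intro h
    rw [h, h0, pow_zero, Nat.cast_one, div_one] at hspec
    linarith
  obtain ⟨j, hj⟩ := Nat.exists_eq_succ_of_ne_zero hne
  have hnot : ¬ ((a j : ℝ) / 2 ^ j ≤ 2 * ε) := Nat.find_min hex (by omega)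
  refine ⟨Nat.find hex, hle, ?_, hspec⟩
  rw [hj] at ⊢
  rw [not_le] at hnot
  have hmj : (a j : ℝ) ≤ a (j + 1) := by exact_mod_cast hmono j
  have h2j : (0 : ℝ) < 2 ^ j := pow_pos two_pos _
  rw [lt_div_iff₀ (pow_pos two_pos _), pow_succ]
  rw [lt_div_iff₀ h2j] at hnot
  nlinarith

/-! ## The stabilizer count along the chain of linear cuts -/

variable {n m : ℕ} {U : Matrix (Fin (n + m) → Bool) (Fin (n + m) → Bool) ℂ}
  {f : (Fin (n + m) → Pauli) → (Fin (n + m) → Pauli)} {c : (Fin (n + m) → Pauli) → ℂ}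

/-- The stabilizer count `a_k` is monotone along the chain `A_k = {i < k}`. -/
theorem card_stab_mono (k : ℕ) :
    ((Fintype.piFinset (fun _ : Fin m => ({Pauli.I, Pauli.Z} : Finset Pauli))).filter
        fun R => f (Fin.append (fun _ : Fin n => Pauli.I) R) ∈
          stringsOn (Finset.univ.filter fun i : Fin (n + m) => i.val < k)).card ≤
    ((Fintype.piFinset (fun _ : Fin m => ({Pauli.I, Pauli.Z} : Finset Pauli))).filter
        fun R => f (Fin.append (fun _ : Fin n => Pauli.I) R) ∈
          stringsOn (Finset.univ.filter fun i : Fin (n + m) => i.val < k + 1)).card := by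
  refine Finset.card_le_card fun R hR => ?_
  rw [Finset.mem_filter] at hR ⊢
  refine ⟨hR.1, stringsOn_mono ?_ hR.2⟩
  intro i hi
  simp only [Finset.mem_filter, Finset.mem_univ, true_and] at hi ⊢
  omega

/-- `a_0 = 1`: only the identity label is a stabilizer supported in the empty cut. -/
theorem card_stab_zero (hU : Uᴴ * U = 1) (hU' : U * Uᴴ = 1)
    (hf : ∀ S, ‖c S‖ = 1 ∧ U * pauliString S * Uᴴ = c S • pauliString (f S)) :
    ((Fintype.piFinset (fun _ : Fin m => ({Pauli.I, Pauli.Z} : Finset Pauli))).filter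
        fun R => f (Fin.append (fun _ : Fin n => Pauli.I) R) ∈
          stringsOn (Finset.univ.filter fun i : Fin (n + m) => i.val < 0)).card = 1 := by
  have hA : (Finset.univ.filter fun i : Fin (n + m) => i.val < 0) = ∅ := by
    ext i; simp
  rw [hA, stringsOn_empty, Finset.card_eq_one]
  refine ⟨fun _ => Pauli.I, ?_⟩
  ext R
  simp only [Finset.mem_filter, Finset.mem_singleton]
  constructor
  · rintro ⟨-, h⟩
    rw [← clifford_map_I hU' hf] at h
    have h2 := clifford_injective hU hf h
    rw [← append_I_I (n := n) (m := m)] at h2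
    exact append_I_injective h2
  · rintro rfl
    refine ⟨mem_piFinset_IZ_of_letter fun _ => Or.inl rfl, ?_⟩
    rw [append_I_I, clifford_map_I hU' hf]

/-- `a_{n+m} = 2^m`: every diagonal ancilla label is a stabilizer supported in the full cut. -/
theorem card_stab_top :
    ((Fintype.piFinset (fun _ : Fin m => ({Pauli.I, Pauli.Z} : Finset Pauli))).filter
        fun R => f (Fin.append (fun _ : Fin n => Pauli.I) R) ∈
          stringsOn (Finset.univ.filter fun i : Fin (n + m) => i.val < n + m)).card = 2 ^ m := by
  have hA : (Finset.univ.filter fun i : Fin (n + m) => i.val < n + m) = Finset.univ :=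
    Finset.filter_true_of_mem fun i _ => i.isLt
  rw [hA, stringsOn_univ, Finset.filter_true_of_mem fun R _ => Finset.mem_univ _, card_piFinset_IZ]

/-! ## The theorem -/

/-- **`SymplecticPurityBound`** (item stmt-QuantumAdvantage-10729 of route SymplecticPurity):
an `ε`-flat unit vector on `n ≥ 1` qubits, padded with any number of `|0⟩` ancillas and rotated
by any semantic Clifford unitary, has a linear cut of purity at most `4ε`. -/
theorem SymplecticPurityBound_proof :
    Summit.QuantumAdvantage.QuantumAdvantage.Theses.SymplecticPurity.SymplecticPurityBound := by
  unfold Summit.QuantumAdvantage.QuantumAdvantage.Theses.SymplecticPurity.SymplecticPurityBound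
  intro n m ε ψ hn hψ hflat U hU hcliff
  classical
  -- the unitary and its label map
  have hUU : Uᴴ * U = 1 := by
    have h := Matrix.mem_unitaryGroup_iff'.1 hU
    rwa [Matrix.star_eq_conjTranspose] at h
  have hUU' : U * Uᴴ = 1 := by
    have h := Matrix.mem_unitaryGroup_iff.1 hU
    rwa [Matrix.star_eq_conjTranspose] at h
  choose f c hcf using hcliff
  have hf : ∀ S, ‖c S‖ = 1 ∧ U * pauliString S * Uᴴ = c S • pauliString (f S) := by
    intro S
    have h := hcf S
    rwa [Matrix.star_eq_conjTranspose] at h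
  -- the state is a unit vector
  have hnorm : ∑ x, ‖(U *ᵥ tensorVec ψ (zeroState m)) x‖ ^ 2 = 1 := by
    have h1 : star (U *ᵥ tensorVec ψ (zeroState m)) ⬝ᵥ (U *ᵥ tensorVec ψ (zeroState m)) =
        (((1 : ℝ)) : ℂ) := by
      rw [star_mulVec_dotProduct_mulVec hUU, star_dotProduct_self,
        normSq_tensorVec_zeroState m hψ]
    have h2 := star_dotProduct_self (U *ᵥ tensorVec ψ (zeroState m))
    rw [h1] at h2
    have h3 : (1 : ℝ) = normSq (U *ᵥ tensorVec ψ (zeroState m)) := by exact_mod_cast h2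
    rw [normSq] at h3
    exact h3.symm
  -- the stabilizer counts along the chain
  set a : ℕ → ℕ := fun k =>
    ((Fintype.piFinset (fun _ : Fin m => ({Pauli.I, Pauli.Z} : Finset Pauli))).filter
      fun R => f (Fin.append (fun _ : Fin n => Pauli.I) R) ∈
        stringsOn (Finset.univ.filter fun i : Fin (n + m) => i.val < k)).card with ha
  have hmono : ∀ k, a k ≤ a (k + 1) := fun k => card_stab_mono k
  have ha0 : a 0 = 1 := card_stab_zero hUU hUU' hf
  have haN : a (n + m) = 2 ^ m := card_stab_top
  -- the cut bound along the chain
  have hcut : ∀ k ≤ n + m,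
      ‖∑ x₁ : QReg (n + m), ∑ x₂ : QReg (n + m), ∑ x₃ : QReg (n + m), ∑ x₄ : QReg (n + m),
        (if (∀ i, k ≤ i.val → x₁ i = x₂ i) ∧ (∀ i, i.val < k → x₂ i = x₃ i) ∧
            (∀ i, k ≤ i.val → x₃ i = x₄ i) ∧ (∀ i, i.val < k → x₄ i = x₁ i)
         then (U *ᵥ tensorVec ψ (zeroState m)) x₁ * star ((U *ᵥ tensorVec ψ (zeroState m)) x₂) *
           (U *ᵥ tensorVec ψ (zeroState m)) x₃ * star ((U *ᵥ tensorVec ψ (zeroState m)) x₄)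
         else 0)‖ ≤ (a k : ℝ) / 2 ^ k + ε ^ 2 * (2 ^ k / a k) := by
    intro k hk
    rw [fourFold_cut_eq k]
    have h := fourFold_le_stab hUU hUU' hf ε hψ hflat
      (Finset.univ.filter fun i : Fin (n + m) => i.val < k)
    rw [Fin.card_filter_val_lt, min_eq_right hk] at h
    exact h
  have ha_pos : ∀ k, (0 : ℝ) < a k := fun k => by
    have : 1 ≤ a k := one_le_card_stab hUU' hf _
    exact_mod_cast this
  clear_value a
  -- case analysis on `ε`
  by_cases hbig : 1 ≤ 4 * ε
  · refine ⟨0, Nat.zero_le _, ?_⟩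
    rw [fourFold_cut_zero, hnorm]
    simp only [one_pow, Complex.ofReal_one, norm_one]
    exact hbig
  have hε4 : 4 * ε < 1 := not_le.1 hbig
  by_cases hsmall : (2 : ℝ) ^ m / 2 ^ (n + m) ≤ 2 * ε
  · -- first passage through the window `(ε, 2ε]`
    have hN : (a (n + m) : ℝ) / 2 ^ (n + m) ≤ 2 * ε := by
      rw [haN]; push_cast; exact hsmall
    obtain ⟨k, hk, hlo, hhi⟩ := exists_first_passage a hmono ha0 (n + m) ε (by linarith) hN
    refine ⟨k, hk, (hcut k hk).trans ?_⟩
    have hεpos : 0 < ε := by linarith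
    have h2k : (0 : ℝ) < 2 ^ k := pow_pos two_pos _
    have hak := ha_pos k
    rw [lt_div_iff₀ h2k] at hlo
    have h3 : ε * 2 ^ k / (a k : ℝ) ≤ 1 := by
      rw [div_le_one hak]; exact hlo.le
    have h2 : ε ^ 2 * (2 ^ k / (a k : ℝ)) ≤ ε := by
      have e : ε ^ 2 * (2 ^ k / (a k : ℝ)) = ε * (ε * 2 ^ k / a k) := by ring
      rw [e]
      calc ε * (ε * 2 ^ k / a k) ≤ ε * 1 := mul_le_mul_of_nonneg_left h3 hεpos.le
        _ = ε := mul_one ε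
    linarith
  · -- impossible range: at the full cut the purity is `1` while the bound is `< 1`
    exfalso
    have hlt : 2 * ε < (2 : ℝ) ^ m / 2 ^ (n + m) := not_le.1 hsmall
    have h := hcut (n + m) le_rfl
    rw [fourFold_cut_top, hnorm, haN] at h
    simp only [one_pow, Complex.ofReal_one, norm_one] at h
    push_cast at h
    have hn1 : (2 : ℝ) ≤ 2 ^ n := by
      calc (2 : ℝ) = 2 ^ 1 := (pow_one _).symm
        _ ≤ 2 ^ n := pow_le_pow_right₀ (by norm_num) hn
    have hpow : (2 : ℝ) ^ (n + m) = 2 ^ n * 2 ^ m := pow_add _ _ _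
    have h2m : (0 : ℝ) < 2 ^ m := pow_pos two_pos _
    have h2n : (0 : ℝ) < 2 ^ n := pow_pos two_pos _
    rw [hpow] at h hlt
    have e1 : (2 : ℝ) ^ m / (2 ^ n * 2 ^ m) = (2 ^ n)⁻¹ := by
      field_simp
    have e2 : (2 : ℝ) ^ n * 2 ^ m / 2 ^ m = 2 ^ n := mul_div_cancel_right₀ _ h2m.ne'
    rw [e1] at h hlt
    rw [e2] at h
    have hεnn : 0 ≤ ε := by
      have hX : (fun _ : Fin n => Pauli.X) ≠ fun _ => Pauli.I := by
        intro hh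
        have := congrFun hh ⟨0, hn⟩
        exact absurd this (by decide)
      exact (norm_nonneg _).trans (hflat _ hX)
    have h6 : 2 * ε * 2 ^ n < (2 ^ n)⁻¹ * 2 ^ n := mul_lt_mul_of_pos_right hlt h2n
    rw [inv_mul_cancel₀ h2n.ne'] at h6
    have h3 : ε ^ 2 * 2 ^ n ≤ ε / 2 := by nlinarith [h6, hεnn]
    have h4 : ((2 : ℝ) ^ n)⁻¹ ≤ 2⁻¹ := inv_anti₀ two_pos hn1
    linarith [h, h3, h4, hε4]

end Summit.QuantumAdvantage.QuantumAdvantage.Theorems.SymplecticPurity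

end
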